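/-
Copyright (c) 2026 the pub-hodgecm-mathlib formalisation cell (harness21).  Prover seat hodgecm-mathlib-K2Liu-p11 (g0), Track B «K2-LIT»,
#184♮ = hLiu418 = `stmt-HodgeConjecture-24832`; LEAD F0P6-plan (g12) DEAL 2026-09-04T06:56:46Z ∕ «= ×3» 07:19:04Z, SIGS-RoadI-v3 §Hol
row H1-E (K2E5-plan (g5)), file E-4c of H1-E = THE DICTIONARY (REPORT-H1E-CENSUS.K2Liu-p11-g0.md §3).  THEOREMS ONLY (no `def`, no
`instance`, no notation, no named-fact hypothesis, no `sorry`).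
-/
import Summits.HodgeConjecture.HodgeConjecture.Theorems.K2LiuHermitianTubeCRChart
import Summits.HodgeConjecture.HodgeConjecture.Theorems.K2LiuHermitianTubeCRDeriv
import HarnessLib

/-!
# Crux `HLiu418`, Road I, organ H1-E: the hermitian-tube Cauchy–Riemann dictionary (`P`-form)

Cell `hodgecm-mathlib`, crux item hLiu418 = `stmt-HodgeConjecture-24832` (helper lane `--supports`, count-neutral).

`exists_holDescend_of_lieCRP` — THE H1-E HEAD in its `P`-form.  Let `Φ : (σ → M_{2n}(ℂ)) → ℂ` (the archimedean part of an adelic form,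
one matrix per place `s : σ`), `k : σ → ℤ`, and suppose, with `U(J) = {g | gᴴ J g = J}`, `𝔲(J) = {Y | Yᴴ J + J Y = 0}`, base point `i·1`:
 (T)  scalar `K∞`-type: `Φ (g u) = (∏_s det(denom u_s (i·1))^{k_s})⁻¹ Φ g` for `u ∈ Stab(i·1)^σ ∩ U(J)^σ`;
 (L)  right Lie derivatives `D s Y g` along `t ↦ update g s (g s · exp (tY))` at every `g ∈ U(J)^σ`, `Y ∈ 𝔲(J)`;
 (L-lin) `D s (a•Y + Y') g = a·D s Y g + D s Y' g`;   (hDc) each `D s Y` continuous on `U(J)^σ`;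
 (CR-P) `D s (μ b) g − 2i·D s (ν b) g = k_s·tr(b)·Φ g` for hermitian `b` (`μ b = (b 0; 0 −b)`, `ν b = (0 b; 0 0)`).
Then there is `f : (σ → M_n(ℂ)) → ℂ` with the (E0) DICTIONARY `f (g·i1) = (∏_s det(denom g_s (i·1))^{k_s}) · Φ g` on `U(J)^σ` and (E1)
`f` HOLOMORPHIC on `ℌ_n^σ` in coordinates — literally the binders `hE0`, `hhol` of ★ `K2LiuHolTubeRigidity.eq_zero_of_hol_of_transl_invariant`
(K2Liu-p10 (g0)).  Proof = assembly of ★ E-1 (`exists_hasFDerivAt_placewiseExp`), ★ E-2 (chart), ★ E-3 (descent, transport, Jacobi),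
★ E-4a (equivalence, product chart, local criterion), ★ E-4b (pull-back derivative, Cauchy–Riemann check) at the explicit ★ H1-B section
`g_Z = transl(Re Z) · levi(√Im Z)`.
The (CR-Cartan) form `D s (μ b) g = i·D s (σ b) g` (`σ b = (0 b; b 0)`; the letters of ★ `K2LiuHermitianTubeFramePMinus`) follows in E-5 from
the `K∞`-type derivative `D s (κ b) g = i k_s tr(b) Φ g` (`κ b = (0 b; −b 0) ∈ 𝔨`, `2ν = σ + κ`).
References: [Shimura1997, §§5–6]; [Bump1997, §2.1]; ball-lane template ★ `UnitaryBallCauchyRiemann`.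
HONEST LABEL: HC_CM is proved only modulo the 7 printed citations (2 remaining named inputs: hLiu418 = stmt-HodgeConjecture-24832,
h413 = stmt-HodgeConjecture-24833) until rung 0 closes; count-neutral helper, closes no socket.
-/

set_option autoImplicit false
set_option linter.dupNamespace false

noncomputable section

open scoped Matrix Topology ComplexOrder MatrixOrder
open Filter Set NormedSpace Complex Matrix
open Literature.NumberTheory.ModularForms.SiegelUpperHalfSpace (num denom moeb num_def denom_def moeb_def moeb_one)
open Literature.AlgebraicGeometry.ShimuraVarieties.KudlaRapoport2013.Sec11Sec12MainTheorem (hermUpperHalfSpace)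
open Literature.NumberTheory.Weil1964.UnitaryBall (sqrt_mul_sqrt_of_posDef conjTranspose_sqrt isUnit_det_sqrt_of_posDef)
open Summit.HodgeConjecture.HodgeConjecture.Cruxes.HLiu418.K2LiuHermitianTubeCocycle
open Summit.HodgeConjecture.HodgeConjecture.Cruxes.HLiu418.K2LiuHermitianTubeAction
open Summit.HodgeConjecture.HodgeConjecture.Cruxes.HLiu418.K2LiuLieRayDifferentiability
open Summit.HodgeConjecture.HodgeConjecture.Cruxes.HLiu418.K2LiuHermitianTubeDescend
open Summit.HodgeConjecture.HodgeConjecture.Cruxes.HLiu418.K2LiuHermitianTubeCRChart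
open Summit.HodgeConjecture.HodgeConjecture.Cruxes.HLiu418.K2LiuHermitianTubeCRDeriv

namespace Summit.HodgeConjecture.HodgeConjecture.Cruxes.HLiu418.K2LiuHermitianTubeCRDictionary

variable {σ : Type*} [Fintype σ] [DecidableEq σ] {n : ℕ}

/-- **THE HERMITIAN-TUBE CAUCHY–RIEMANN DICTIONARY (`P`-form).**  A `K∞`-typed group function with continuous right Lie derivatives
satisfying the `P`-form Cauchy–Riemann relation descends to a function on `ℌ_n^σ` that is HOLOMORPHIC in coordinates and satisfies the
(E0) dictionary — the `hE0`/`hhol` binders of ★ `K2LiuHolTubeRigidity.eq_zero_of_hol_of_transl_invariant` verbatim.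
[cite: Shimura1997, §§5–6] [cite: Bump1997, §2.1] -/
theorem exists_holDescend_of_lieCRP (k : σ → ℤ) (Φ : (σ → Matrix (Fin n ⊕ Fin n) (Fin n ⊕ Fin n) ℂ) → ℂ)
    (hT : ∀ g u : σ → Matrix (Fin n ⊕ Fin n) (Fin n ⊕ Fin n) ℂ,
      (∀ s, (g s)ᴴ * Matrix.J (Fin n) ℂ * g s = Matrix.J (Fin n) ℂ) →
      (∀ s, (u s)ᴴ * Matrix.J (Fin n) ℂ * u s = Matrix.J (Fin n) ℂ) → (∀ s, moeb (u s) (I • 1) = I • 1) →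
      Φ (g * u) = (∏ s, (denom (u s) (I • (1 : Matrix (Fin n) (Fin n) ℂ))).det ^ k s)⁻¹ * Φ g)
    (D : σ → Matrix (Fin n ⊕ Fin n) (Fin n ⊕ Fin n) ℂ → (σ → Matrix (Fin n ⊕ Fin n) (Fin n ⊕ Fin n) ℂ) → ℂ)
    (hD : ∀ (s : σ) (Y : Matrix (Fin n ⊕ Fin n) (Fin n ⊕ Fin n) ℂ) (g : σ → Matrix (Fin n ⊕ Fin n) (Fin n ⊕ Fin n) ℂ),
      Yᴴ * Matrix.J (Fin n) ℂ + Matrix.J (Fin n) ℂ * Y = 0 →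
      (∀ s', (g s')ᴴ * Matrix.J (Fin n) ℂ * g s' = Matrix.J (Fin n) ℂ) →
      HasDerivAt (fun t : ℝ => Φ (Function.update g s (g s * exp (t • Y)))) (D s Y g) 0)
    (hDl : ∀ (s : σ) (g : σ → Matrix (Fin n ⊕ Fin n) (Fin n ⊕ Fin n) ℂ) (a : ℝ)
      (Y Y' : Matrix (Fin n ⊕ Fin n) (Fin n ⊕ Fin n) ℂ),
      Yᴴ * Matrix.J (Fin n) ℂ + Matrix.J (Fin n) ℂ * Y = 0 → Y'ᴴ * Matrix.J (Fin n) ℂ + Matrix.J (Fin n) ℂ * Y' = 0 →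
      (∀ s', (g s')ᴴ * Matrix.J (Fin n) ℂ * g s' = Matrix.J (Fin n) ℂ) →
      D s (a • Y + Y') g = (a : ℂ) * D s Y g + D s Y' g)
    (hDc : ∀ (s : σ) (Y : Matrix (Fin n ⊕ Fin n) (Fin n ⊕ Fin n) ℂ), Yᴴ * Matrix.J (Fin n) ℂ + Matrix.J (Fin n) ℂ * Y = 0 →
      ContinuousOn (D s Y) {g | ∀ s', (g s')ᴴ * Matrix.J (Fin n) ℂ * g s' = Matrix.J (Fin n) ℂ})
    (hCR : ∀ (s : σ) (b : Matrix (Fin n) (Fin n) ℂ) (g : σ → Matrix (Fin n ⊕ Fin n) (Fin n ⊕ Fin n) ℂ), bᴴ = b →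
      (∀ s', (g s')ᴴ * Matrix.J (Fin n) ℂ * g s' = Matrix.J (Fin n) ℂ) →
      D s (fromBlocks b 0 0 (-b)) g - 2 * I * D s (fromBlocks 0 b 0 0) g = (k s : ℂ) * b.trace * Φ g) :
    ∃ f : (σ → Matrix (Fin n) (Fin n) ℂ) → ℂ,
      (∀ g : σ → Matrix (Fin n ⊕ Fin n) (Fin n ⊕ Fin n) ℂ, (∀ s, (g s)ᴴ * Matrix.J (Fin n) ℂ * g s = Matrix.J (Fin n) ℂ) →
        f (fun s => moeb (g s) (I • 1)) = (∏ s, (denom (g s) (I • (1 : Matrix (Fin n) (Fin n) ℂ))).det ^ k s) * Φ g) ∧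
      DifferentiableOn ℂ (fun z : σ → Fin n → Fin n → ℂ => f fun s => Matrix.of (z s))
        {z | ∀ s, Matrix.of (z s) ∈ hermUpperHalfSpace n} := by
  classical
  -- the explicit Siegel section of ★ H1-B (kept opaque behind `hsec`) and the descended function (behind `hf`)
  obtain ⟨sec, hsec⟩ : ∃ sec : Matrix (Fin n) (Fin n) ℂ → Matrix (Fin n ⊕ Fin n) (Fin n ⊕ Fin n) ℂ, ∀ W, sec W =
      fromBlocks 1 ((2 : ℂ)⁻¹ • (W + Wᴴ)) 0 1 *
        fromBlocks (CFC.sqrt ((2 * I)⁻¹ • (W - Wᴴ))) 0 0 (CFC.sqrt ((2 * I)⁻¹ • (W - Wᴴ)))⁻¹ := ⟨_, fun W => rfl⟩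
  have hsecU : ∀ {W : Matrix (Fin n) (Fin n) ℂ}, ((2 * I)⁻¹ • (W - Wᴴ)).PosDef →
      (sec W)ᴴ * Matrix.J (Fin n) ℂ * sec W = Matrix.J (Fin n) ℂ := fun {W} hW => by rw [hsec]; exact section_mem hW
  have hsecI : ∀ {W : Matrix (Fin n) (Fin n) ℂ}, ((2 * I)⁻¹ • (W - Wᴴ)).PosDef →
      moeb (sec W) (I • 1) = W := fun {W} hW => by rw [hsec]; exact moeb_section_I hW
  obtain ⟨f, hf⟩ : ∃ f : (σ → Matrix (Fin n) (Fin n) ℂ) → ℂ, ∀ Z, f Z =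
      if ∀ s, ((2 * I)⁻¹ • (Z s - (Z s)ᴴ)).PosDef then
        (∏ s, (denom (sec (Z s)) (I • (1 : Matrix (Fin n) (Fin n) ℂ))).det ^ k s) * Φ (fun s => sec (Z s))
      else 0 := ⟨_, fun Z => rfl⟩
  -- (E0)
  have hE0 : ∀ g : σ → Matrix (Fin n ⊕ Fin n) (Fin n ⊕ Fin n) ℂ,
      (∀ s, (g s)ᴴ * Matrix.J (Fin n) ℂ * g s = Matrix.J (Fin n) ℂ) →
      f (fun s => moeb (g s) (I • 1)) = (∏ s, (denom (g s) (I • (1 : Matrix (Fin n) (Fin n) ℂ))).det ^ k s) * Φ g := by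
    intro g hg
    have hpos : ∀ s, ((2 * I)⁻¹ • (moeb (g s) (I • (1 : Matrix (Fin n) (Fin n) ℂ)) -
        (moeb (g s) (I • (1 : Matrix (Fin n) (Fin n) ℂ)))ᴴ)).PosDef :=
      fun s => posDef_im_moeb (hg s) posDef_im_I_smul_one
    rw [hf, if_pos hpos]
    exact prod_zpow_mul_eq_of_moeb_eq k Φ hT (fun s => hsecU (hpos s)) hg (fun s => hsecI (hpos s))
  refine ⟨f, hE0, ?_⟩
  -- (E1): complex differentiability at every point of the tube
  intro z hz
  apply DifferentiableAt.differentiableWithinAt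
  -- the point and its section data
  have hZ₀ : ∀ s, ((2 * I)⁻¹ • (Matrix.of (z s) - (Matrix.of (z s))ᴴ)).PosDef := fun s => hz s
  obtain ⟨X₀, hX₀⟩ : ∃ X₀ : σ → Matrix (Fin n) (Fin n) ℂ, ∀ s, X₀ s = (2 : ℂ)⁻¹ • (Matrix.of (z s) + (Matrix.of (z s))ᴴ) :=
    ⟨_, fun s => rfl⟩
  obtain ⟨R₀, hR₀⟩ : ∃ R₀ : σ → Matrix (Fin n) (Fin n) ℂ, ∀ s, R₀ s = CFC.sqrt ((2 * I)⁻¹ • (Matrix.of (z s) - (Matrix.of (z s))ᴴ)) :=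
    ⟨_, fun s => rfl⟩
  obtain ⟨g₀, hg₀⟩ : ∃ g₀ : σ → Matrix (Fin n ⊕ Fin n) (Fin n ⊕ Fin n) ℂ,
      ∀ s, g₀ s = fromBlocks 1 (X₀ s) 0 1 * fromBlocks (R₀ s) 0 0 (R₀ s)⁻¹ := ⟨_, fun s => rfl⟩
  have hg₀U : ∀ s, (g₀ s)ᴴ * Matrix.J (Fin n) ℂ * g₀ s = Matrix.J (Fin n) ℂ := fun s => by
    rw [hg₀, hX₀, hR₀]; exact section_mem (hZ₀ s)
  have hR₀u : ∀ s, IsUnit (R₀ s).det := fun s => by rw [hR₀]; exact isUnit_det_sqrt_of_posDef (hZ₀ s)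
  have hR₀sq : ∀ s, R₀ s * R₀ s = (2 * I)⁻¹ • (Matrix.of (z s) - (Matrix.of (z s))ᴴ) := fun s => by
    rw [hR₀]; exact sqrt_mul_sqrt_of_posDef (hZ₀ s)
  -- hermitian coordinates, chart generator, linear parts
  obtain ⟨η, hηH, hηi, hηs⟩ := (exists_hermCoord : ∃ η : (Fin n → Fin n → ℝ) →L[ℝ] Matrix (Fin n) (Fin n) ℂ, _)
  obtain ⟨Λ, hΛ⟩ := exists_chartGen (l := Fin n) η
  have hΛmem : ∀ y, (Λ y)ᴴ * Matrix.J (Fin n) ℂ + Matrix.J (Fin n) ℂ * Λ y = 0 := by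
    intro y; rw [hΛ]; exact chart_gen_mem (hηH y.1) (hηH y.2)
  have hexpU : ∀ y, (exp (Λ y))ᴴ * Matrix.J (Fin n) ℂ * exp (Λ y) = Matrix.J (Fin n) ℂ := by
    intro y
    have h := conjTranspose_exp_mul_J_mul_exp (hΛmem y) 1
    rwa [one_smul] at h
  choose A hA using fun s => exists_chartEquiv (R₀ s) (hR₀u s) η hηH hηi hηs
  have hA' : ∀ s (y : (Fin n → Fin n → ℝ) × (Fin n → Fin n → ℝ)), (A s y : Fin n → Fin n → ℂ) = fun i j =>
      (R₀ s * ((Λ y).toBlocks₁₂ + (Λ y).toBlocks₂₁ + I • ((Λ y).toBlocks₁₁ - (Λ y).toBlocks₂₂)) * R₀ s) i j := by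
    intro s y
    rw [hA s y, hΛ, toBlocks_fromBlocks₁₂, toBlocks_fromBlocks₂₁, toBlocks_fromBlocks₁₁, toBlocks_fromBlocks₂₂, add_zero,
      sub_neg_eq_add, ← two_smul ℂ, smul_smul, mul_comm I 2]
  -- the product chart and its strict derivative (★ E-2 ∕ E-4a)
  have hχ := hasStrictFDerivAt_prodChart X₀ R₀ Λ A hA'
  -- the pull-back `Q = J^k Φ` and its derivative (★ E-1 ∕ E-3 ∕ E-4b)
  obtain ⟨L, hQ, hL⟩ := exists_hasFDerivAt_pullback k Φ D hD hDl hDc Λ hΛmem g₀ hg₀U (fun s => (R₀ s)⁻¹)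
    (fun s => by rw [det_nonsing_inv]; exact (hR₀u s).ringInverse)
    (fun s M => by rw [hg₀]; exact denom_section_mul (X₀ s) (R₀ s) M)
  -- `f ∘ χ = Q`, by (E0) at `g₀ · exp Λ`
  have hFQ : ∀ y : σ → (Fin n → Fin n → ℝ) × (Fin n → Fin n → ℝ),
      (fun z' : σ → Fin n → Fin n → ℂ => f fun s => Matrix.of (z' s))
        (fun s => fun i j => (R₀ s * moeb (exp (Λ (y s))) (I • (1 : Matrix (Fin n) (Fin n) ℂ)) * R₀ s + X₀ s) i j) =
      (∏ s, (denom (g₀ s * exp (Λ (y s))) (I • (1 : Matrix (Fin n) (Fin n) ℂ))).det ^ k s) *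
        Φ (fun s => g₀ s * exp (Λ (y s))) := by
    intro y
    have hpt : (fun s => Matrix.of (fun i j => (R₀ s * moeb (exp (Λ (y s))) (I • (1 : Matrix (Fin n) (Fin n) ℂ)) * R₀ s + X₀ s) i j)) =
        fun s => moeb (g₀ s * exp (Λ (y s))) (I • 1) := by
      funext s
      rw [hg₀, moeb_section_mul (hR₀u s) (hexpU (y s))]
      rfl
    simp only
    rw [hpt]
    exact hE0 _ fun s => mul_mem_UJ (hg₀U s) (hexpU (y s))
  -- the complex structure on the chart: `𝒥 (r₁, r₂) = (−2 r₂, ½ r₁)` placewise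
  have h𝒜 : ∀ y : σ → (Fin n → Fin n → ℝ) × (Fin n → Fin n → ℝ),
      (ContinuousLinearEquiv.piCongrRight A) (fun s => ((-(2 : ℝ)) • (y s).2, (2 : ℝ)⁻¹ • (y s).1)) =
        I • (ContinuousLinearEquiv.piCongrRight A) y := by
    intro y
    funext s
    rw [ContinuousLinearEquiv.piCongrRight_apply, Pi.smul_apply, ContinuousLinearEquiv.piCongrRight_apply]
    exact chartEquiv_J (R₀ s) η (A s) (hA s) (y s)
  have hLJ : ∀ y : σ → (Fin n → Fin n → ℝ) × (Fin n → Fin n → ℝ),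
      L (fun s => ((-(2 : ℝ)) • (y s).2, (2 : ℝ)⁻¹ • (y s).1)) = I * L y := by
    intro y
    rw [hL, hL]
    simp only [Finset.mul_sum]
    refine Finset.sum_congr rfl fun s _ => ?_
    have h := pullbackDeriv_J k Φ D hDl η hηH Λ hΛ hg₀U s (fun b hb => hCR s b g₀ hb hg₀U) (y s)
    rw [h]
    ring
  -- the criterion (★ E-4a)
  have hdiff := differentiableAt_complex_of_chart hχ hQ (Eventually.of_forall hFQ)
    (fun y s => ((-(2 : ℝ)) • (y s).2, (2 : ℝ)⁻¹ • (y s).1)) h𝒜 hLJ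
  -- the chart is centred at `z`
  have hχ0 : (fun s => fun i j =>
      (R₀ s * moeb (exp (Λ ((0 : σ → (Fin n → Fin n → ℝ) × (Fin n → Fin n → ℝ)) s))) (I • (1 : Matrix (Fin n) (Fin n) ℂ)) *
        R₀ s + X₀ s) i j : σ → Fin n → Fin n → ℂ) = z := by
    funext s i j
    simp only [Pi.zero_apply, map_zero, NormedSpace.exp_zero, moeb_one]
    rw [Matrix.mul_smul, Matrix.mul_one, Matrix.smul_mul, hR₀sq, hX₀, add_comm, re_add_I_smul_im]
    rfl
  rw [hχ0] at hdiff
  exact hdiff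

end Summit.HodgeConjecture.HodgeConjecture.Cruxes.HLiu418.K2LiuHermitianTubeCRDictionary

end
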